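import Summits.ResolutionOfSingularities.ResolutionOfSingularities.Theorems.FrobeniusLadderFRationalResolutionRootAdjoinRegularOfDerivation
import Mathlib.RingTheory.Localization.AtPrime.Basic
import Mathlib.RingTheory.Polynomial.Basic
import HarnessLib

/-!
# Crux `FrobeniusLadder.FRationalResolution` (stmt-ResolutionOfSingularities-15317), line `redirect`,
# stub `stub_diagonalizableQuotientResolution` — item (F2b-core): the derivation certificate for the regularity of the
# root-adjunction chart `S̃ = S[w]/(w^d − u)` TRANSPORTS along any ring map `ψ : S → F`; a derivation of a QUOTIENT `S ⧸ I`
# (`I` inside the point) that does not vanish on `u` at the point suffices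

`…RootAdjoinRegularOfDerivation.not_mem_sq_of_derivation` certifies `X^d − C u ∉ (𝔓'S[X]_{𝔓'})²` by a derivation `D` of `S`
itself with `D u ∉ 𝔓' ∩ S`. In the residual case of MEMO-15317-leafhand2-g21 §3 (`deg u ∈ pA`) no such derivation of `S` is at
hand, but one exists on a quotient of `S` (the Euler derivation of an additive character of the unit-degree SUBGROUP, next
file). This file supplies the transport:

* `mem_pow_maximalIdeal_of_comap_eq` — for `f : R → P` and primes `J ∩ R = I`, the induced `R_I → P_J` is local
  (Mathlib `Localization.localRingHom`), so `x ∈ 𝔪_{R_I}^n ⇒ f x ∈ 𝔪_{P_J}^n`;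
* `not_mem_sq_of_derivation_map` — `ψ : S → F`, a prime `𝔑` of `F[X]` with `𝔑 ∩ S[X] = 𝔓'`, a derivation `D` of `F` with
  `D (ψ u) ∉ 𝔑 ∩ F` ⇒ `X^d − C u ∉ (𝔓'S[X]_{𝔓'})²` (any `d`, any characteristic);
* `isRegularLocalRing_localization_adjoinRoot_of_derivation_map` — hence `(AdjoinRoot (X^d − C u))_𝔓` is regular when `S` is;
* ★ `isRegularLocalRing_localization_adjoinRoot_of_quotient_derivation` — the case `F = S ⧸ I`, `I ⊆ 𝔓 ∩ S`: a derivation `D` of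
  `S ⧸ I` with `D ū ∉ (𝔓 ∩ S)/I` gives regularity of `S̃` at `𝔓` (the prime `𝔑 = 𝔓'·(S ⧸ I)[X]` is supplied here).

Honest label: helper toward ONE leaf stub; no stub, crux or summit closed. No definitions, no named facts, no sorry.
[cite: Matsumura1987, Thm. 14.2; §25] [folklore]
-/

noncomputable section

-- single-problem summit: the doubled namespace component is forced
set_option linter.dupNamespace false

open IsLocalRing Polynomial

namespace Summit.ResolutionOfSingularities.ResolutionOfSingularities.Theorems.FRationalResolution.RootAdjoinRegularTransport

universe u v

/-! ### Transport of `𝔪^n`-membership along a map compatible with the primes -/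

/-- **Powers of the maximal ideal are respected by the induced local map.** For `f : R → P`, primes `I ⊂ R`, `J ⊂ P` with
`J ∩ R = I`, and `x ∈ R` whose image in `R_I` lies in `𝔪^n`, the image of `f x` in `P_J` lies in `𝔪^n` (the induced map
`R_I → P_J` is a local homomorphism). [folklore] -/
theorem mem_pow_maximalIdeal_of_comap_eq {R P : Type*} [CommRing R] [CommRing P] (f : R →+* P)
    (I : Ideal R) [I.IsPrime] (J : Ideal P) [J.IsPrime] (hIJ : J.comap f = I) (n : ℕ) {x : R}
    (hx : algebraMap R (Localization.AtPrime I) x ∈ maximalIdeal (Localization.AtPrime I) ^ n) :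
    algebraMap P (Localization.AtPrime J) (f x) ∈ maximalIdeal (Localization.AtPrime J) ^ n := by
  set φ := Localization.localRingHom I J f hIJ.symm with hφ
  have h1 : φ (algebraMap R _ x) ∈ (maximalIdeal (Localization.AtPrime I) ^ n).map φ := Ideal.mem_map_of_mem φ hx
  rw [Ideal.map_pow, hφ, Localization.localRingHom_to_map] at h1
  exact Ideal.pow_right_mono (IsLocalRing.map_maximalIdeal_le _) n h1

/-! ### A derivation of an `S`-algebra certifies `X^d − u ∉ 𝔓'^{(2)}` -/

/-- **Derivation certificate along a ring map.** `ψ : S → F`, `D` a derivation of `F`, `𝔓'` a prime of `S[X]` containing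
`X^d − C u`, `𝔑` a prime of `F[X]` with `𝔑 ∩ S[X] = 𝔓'` (along `Polynomial.mapRingHom ψ`): if `D (ψ u) ∉ 𝔑 ∩ F`, then the
image of `X^d − C u` in `S[X]_{𝔓'}` is not in the square of the maximal ideal. Any `d`, any characteristic.
[cite: Matsumura1987, §25] -/
theorem not_mem_sq_of_derivation_map {S : Type u} {F : Type v} [CommRing S] [CommRing F] (ψ : S →+* F)
    (D : Derivation ℤ F F) (u : S) (d : ℕ) (𝔓' : Ideal S[X]) [𝔓'.IsPrime] (hf : (X ^ d - C u : S[X]) ∈ 𝔓')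
    (𝔑 : Ideal F[X]) [𝔑.IsPrime] (h𝔑 : 𝔑.comap (mapRingHom ψ) = 𝔓') (hDu : D (ψ u) ∉ 𝔑.comap C) :
    algebraMap S[X] (Localization.AtPrime 𝔓') (X ^ d - C u) ∉ maximalIdeal (Localization.AtPrime 𝔓') ^ 2 := by
  intro hmem
  have h1 := mem_pow_maximalIdeal_of_comap_eq (mapRingHom ψ) 𝔓' 𝔑 h𝔑 2 hmem
  have hmap : mapRingHom ψ (X ^ d - C u : S[X]) = X ^ d - C (ψ u) := by
    rw [coe_mapRingHom, Polynomial.map_sub, Polynomial.map_pow, map_X, map_C]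
  rw [hmap] at h1
  refine RootAdjoinRegularOfDerivation.not_mem_sq_of_derivation D (ψ u) d 𝔑 ?_ hDu h1
  rw [← hmap, ← Ideal.mem_comap, h𝔑]; exact hf

/-- **Regularity of `(AdjoinRoot (X^d − C u))_𝔓` from a derivation of an `S`-algebra.** `S` a regular ring, `ψ : S → F`, a prime
`𝔑` of `F[X]` contracting to the preimage `𝔓'` of `𝔓` in `S[X]`, and a derivation `D` of `F` with `D (ψ u) ∉ 𝔑 ∩ F`.
[cite: Matsumura1987, Thm. 14.2; §25] -/
theorem isRegularLocalRing_localization_adjoinRoot_of_derivation_map {S : Type u} {F : Type v} [CommRing S]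
    [IsRegularRing S] [CommRing F] (ψ : S →+* F) (D : Derivation ℤ F F) (u : S) (d : ℕ)
    (𝔓 : Ideal (AdjoinRoot (X ^ d - C u : S[X]))) [𝔓.IsPrime] (𝔑 : Ideal F[X]) [𝔑.IsPrime]
    (h𝔑 : 𝔑.comap (mapRingHom ψ) = 𝔓.comap (AdjoinRoot.mk (X ^ d - C u : S[X])))
    (hDu : D (ψ u) ∉ 𝔑.comap C) :
    IsRegularLocalRing (Localization.AtPrime 𝔓) := by
  haveI : (𝔓.comap (AdjoinRoot.mk (X ^ d - C u : S[X]))).IsPrime := Ideal.IsPrime.comap _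
  refine HypersurfaceLocalRegular.isRegularLocalRing_localization_adjoinRoot_of_not_mem_sq _ 𝔓
    (not_mem_sq_of_derivation_map ψ D u d _ ?_ 𝔑 h𝔑 hDu)
  rw [Ideal.mem_comap, AdjoinRoot.mk_self]; exact 𝔓.zero_mem

/-! ### The quotient case -/

/-- ★ **Regularity of `(AdjoinRoot (X^d − C u))_𝔓` from a derivation of a quotient `S ⧸ I`.** `S` a regular ring, `I` an ideal
contained in `𝔔₁ = 𝔓 ∩ S`, and `D` a derivation of `S ⧸ I` whose value on `ū` is not in `𝔔₁/I`. Then `(S[X]/(X^d − u))_𝔓` is a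
regular local ring. (The prime of `(S ⧸ I)[X]` used is the image of the preimage `𝔓'` of `𝔓`; it contracts back to `𝔓'`
because the kernel `I[X]` lies inside `𝔓'`.) [cite: Matsumura1987, Thm. 14.2; §25] -/
theorem isRegularLocalRing_localization_adjoinRoot_of_quotient_derivation {S : Type u} [CommRing S] [IsRegularRing S]
    (I : Ideal S) (D : Derivation ℤ (S ⧸ I) (S ⧸ I)) (u : S) (d : ℕ)
    (𝔓 : Ideal (AdjoinRoot (X ^ d - C u : S[X]))) [𝔓.IsPrime]
    (hI : I ≤ 𝔓.comap (AdjoinRoot.of (X ^ d - C u : S[X])))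
    (hDu : D (Ideal.Quotient.mk I u) ∉ (𝔓.comap (AdjoinRoot.of (X ^ d - C u : S[X]))).map (Ideal.Quotient.mk I)) :
    IsRegularLocalRing (Localization.AtPrime 𝔓) := by
  haveI h𝔓'p : (𝔓.comap (AdjoinRoot.mk (X ^ d - C u : S[X]))).IsPrime := Ideal.IsPrime.comap _
  -- `𝔓 ∩ S = 𝔓' ∩ S`
  have hof : 𝔓.comap (AdjoinRoot.of (X ^ d - C u : S[X])) = (𝔓.comap (AdjoinRoot.mk (X ^ d - C u : S[X]))).comap C := by
    rw [Ideal.comap_comap]; rfl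
  -- the kernel `I[X]` of `S[X] → (S ⧸ I)[X]` lies in `𝔓'`
  have hsurj : Function.Surjective (mapRingHom (Ideal.Quotient.mk I)) :=
    Polynomial.map_surjective _ Ideal.Quotient.mk_surjective
  have hker : RingHom.ker (mapRingHom (Ideal.Quotient.mk I)) ≤ 𝔓.comap (AdjoinRoot.mk (X ^ d - C u : S[X])) := by
    rw [Polynomial.ker_mapRingHom, Ideal.mk_ker, Ideal.map_le_iff_le_comap, ← hof]
    exact hI
  haveI h𝔑 : ((𝔓.comap (AdjoinRoot.mk (X ^ d - C u : S[X]))).map (mapRingHom (Ideal.Quotient.mk I))).IsPrime :=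
    Ideal.map_isPrime_of_surjective hsurj hker
  have hcomap : ((𝔓.comap (AdjoinRoot.mk (X ^ d - C u : S[X]))).map (mapRingHom (Ideal.Quotient.mk I))).comap
      (mapRingHom (Ideal.Quotient.mk I)) = 𝔓.comap (AdjoinRoot.mk (X ^ d - C u : S[X])) := by
    rw [Ideal.comap_map_of_surjective _ hsurj]
    exact sup_eq_left.2 (le_trans (fun x hx => hx) hker)
  refine isRegularLocalRing_localization_adjoinRoot_of_derivation_map (Ideal.Quotient.mk I) D u d 𝔓 _ hcomap ?_
  -- `D ū ∉ 𝔑 ∩ (S ⧸ I)`: a lift `s` of `D ū` would lie in `𝔓' ∩ S = 𝔓 ∩ S`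
  intro hmem
  obtain ⟨s, hs⟩ := Ideal.Quotient.mk_surjective (D (Ideal.Quotient.mk I u))
  have h1 : mapRingHom (Ideal.Quotient.mk I) (C s) ∈
      (𝔓.comap (AdjoinRoot.mk (X ^ d - C u : S[X]))).map (mapRingHom (Ideal.Quotient.mk I)) := by
    rw [coe_mapRingHom, map_C, hs]; exact Ideal.mem_comap.1 hmem
  have h2 : C s ∈ 𝔓.comap (AdjoinRoot.mk (X ^ d - C u : S[X])) := by rw [← hcomap, Ideal.mem_comap]; exact h1
  have h3 : s ∈ 𝔓.comap (AdjoinRoot.of (X ^ d - C u : S[X])) := by rw [hof, Ideal.mem_comap]; exact h2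
  exact hDu (by rw [← hs]; exact Ideal.mem_map_of_mem _ h3)

end Summit.ResolutionOfSingularities.ResolutionOfSingularities.Theorems.FRationalResolution.RootAdjoinRegularTransport

end
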